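import Summits.AtomisticToContinuum.HydrodynamicLimit.Theses.AntiMazurCoboundaries
import Summits.AtomisticToContinuum.HydrodynamicLimit.Theses.FluxGibbsianityLdDrude
import Summits.AtomisticToContinuum.HydrodynamicLimit.Theses.TwoClocks
import Summits.AtomisticToContinuum.HydrodynamicLimit.Theses.OneFlightGossipEngine
import Summits.AtomisticToContinuum.HydrodynamicLimit.Theorems.ImplosionDichotomyHydroLimitInBandSignedInputs
import Summits.AtomisticToContinuum.HydrodynamicLimit.Theorems.ImplosionDichotomyHydroLimitProfilewiseBandKcwfQReduction
import Summits.AtomisticToContinuum.HydrodynamicLimit.Theorems.AntiMazurCoboundariesKineticWindowGronwallClockFromInstance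
import Summits.AtomisticToContinuum.HydrodynamicLimit.Theorems.AntiMazurCoboundariesKineticWindowGronwallSplit
import Summits.AtomisticToContinuum.HydrodynamicLimit.Theorems.AntiMazurCoboundariesKineticWindowGronwallRareBandDock
import Summits.AtomisticToContinuum.HydrodynamicLimit.Theorems.AntiMazurCoboundariesKineticWindowGronwallSignedDock

/-!
# Crux `KineticWindowGronwall` (stmt-AtomisticToContinuum-9282) — skeleton line `board-node-dock`, v5 (lead c7, 2026-08-17 13:xxZ:
# RE-DOCKED ON THE SIGNED-BAND HEART; every registered stub is an EXISTING BOARD ITEM)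

Crux (FIXED, route AntiMazurCoboundaries, shared verbatim with FluxGibbsianityLdDrude):
`KineticWindowGronwall := KineticFluxLdDecay → RelEntropyVanishing` (`A → B`).

THE CUT (same composition idea as v1–v4: dock the crux's consequent on the board's one-window entropy clock through LANDED reductions;
the registered stubs are the clock's open inputs). What changed: v1–v4 docked on the heart of 2026-08-16 (`ClockFromInstance`, lead c3),
whose inputs were the local transfer node 17691, TwoClocks' `TransferActivityTails` 16624, `EnergyCurrentTails` 9235, `DiluteSelfConsistency`
3091, the TRUE-LAW weighted coherence `CoherentSuprathermalContentVanishesW` (no board item) and a bespoke bounds-uniform general-`F` kinetic node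
(no board item). Meanwhile (2026-08-17T06–11Z) the heart's own lines (crux 9133 lead c17, crux 17372 leads c7–c8) re-threaded the clock around the
refuted coherence input `BandCoherenceLDAlongFamilies` (stmt-17700, Galilean boost): SIGNED band remainder, the suprathermal heat flux paid at a
RATE by `SuperExponentialEnergyTails` (SEET, stmt-17701 — "this is what removes the heart's true-law coherence child (ii)"), the kinetic input
reduced to the CLASS-UNIFORM node KCWF-Q (stmt-18052, itself a corollary of crux 16659's single registered stub `KCWUSharpPlus`). All of it is
LANDED (`HydroLimitInBandSignedBand.hydroLimitInBand_of_signedInputs`, p148646; `HydroLimitProfilewiseBandKcwfQ.kcwfQ_of_kcwuSharpPlus`, p152422)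
and its penultimate line is exactly the guarded Grönwall core `HydroLimitInBandOfHeart.GronwallCoreInBand`, which lead c3 of THIS crux already
un-guards into `RelEntropyVanishing` verbatim (`KineticWindowGronwallClockFromInstance.relEntropyVanishing_of_gronwallCoreInBand`, landed, using
`DiluteSelfConsistency`). v5 composes the two. Registered stubs (six, every one an existing board item BY NAME):

* `stub_seet  : OneFlightGossipEngine.SuperExponentialEnergyTails`        (stmt-17701, crux, open)
* `stub_kcwfQ : OneFlightGossipEngine.KineticCurrentsLDAlongFamiliesQ`     (stmt-18052, crux, open; ⟸ `KCWUSharpPlus` = 16659's stub, landed)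
* `stub_lctf  : OneFlightGossipEngine.LocalClampedTransferLDAlongFamilies` (stmt-17691, crux, open)
* `stub_eat   : OneFlightGossipEngine.EnergyActivityTails`                 (stmt-17703, crux, open)
* `stub_cat   : OneFlightGossipEngine.CollisionActivityTails`              (stmt-13734, crux, open)
* `stub_dsc   : TwoClocks.DiluteSelfConsistency`                           (stmt-3091, open; the un-guarding input — `B` is the UNGUARDED Yau target)

Composition `KineticWindowGronwall_of : stub_seet → stub_kcwfQ → stub_lctf → stub_eat → stub_cat → stub_dsc → KineticWindowGronwall` is sorry-free
and concludes the crux BY NAME (both route decls). Consequences: (1) the crux carries NO content beyond glue over six items staffed on their own seats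
(lead a1's verdict — antecedent idle — in its final form); (2) the v4/split children 1 and 2 LEAVE the cone: `CoherentSuprathermalContentVanishesW`
(which, tested against a Galilean gust of bounded entropy cost per particle, contains the velocity-field LLN along the evolution — target-grade,
see LEAD-c7 §5) is not needed, and the bounds-uniform node `KineticWindowLDBoundsUniform` is only a SUFFICIENT condition for `stub_kcwfQ`
(`kcwfQ_of_child₁` below, sorry-free: child 1 ⟹ `KCWUSharpPlus` ⟹ KCWF-Q); (3) the recommended planner action is a six-way `--split` of 9282 onto
the items 17701/18052/17691/17703/13734/3091 (dedup-attach) with `--glue-by` the landed twin of `KineticWindowGronwall_of`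
(`Theorems/AntiMazurCoboundariesKineticWindowGronwallSignedDock.lean`).

HONESTY. `A` is idle (as in every checked skeleton of this crux): `A ⇐ EquilibriumFastWindowLD (14440)` is landed and 14440 is the constant-profile
case of the kinetic node. `stub_dsc` is load-bearing because `B` quantifies over ALL classical solutions (no packing guard); the planners' KILL
CRITERION (a dense excursion, stmt-12586, would make `B` false and the crux false given `A`) is inherited unchanged from v1–v4.

Disproof.lean (cdisprove c1–c3, unchanged since 2026-08-16T05:08Z): §1 no kill; §2–§3 tie and balance laws inside the landed clock; §4 nothing cubic is
exponentiated (the kinetic stub is quadratic-class; the cubic tail is paid in MEAN by SEET/EAT/CAT); §7/§8/§10 the kinetic stub has `x`-dependent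
activity, packing guard, existential tilt radius after the bounds; §12–§13 Targets concern the dead explosion line only.
-/

noncomputable section

open scoped BigOperators ENNReal Classical
open MeasureTheory Set

namespace Summit.AtomisticToContinuum.HydrodynamicLimit.Cruxes.KineticWindowGronwall.BoardNodeDock

open Summit.AtomisticToContinuum.HydrodynamicLimit.Theses
open Summit.AtomisticToContinuum.HydrodynamicLimit.Theses.AntiMazurCoboundaries
  (KineticFluxLdDecay RelEntropyVanishing KineticWindowGronwall)
open Summit.AtomisticToContinuum.HydrodynamicLimit.Theses.TwoClocks (EquilibriumFastWindowLD DiluteSelfConsistency)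
open Summit.AtomisticToContinuum.HydrodynamicLimit.Theorems
open Summit.AtomisticToContinuum.HydrodynamicLimit.Theorems.HydroLimitInBandOfHeart (GronwallCoreInBand)
open Literature.Analysis.FluidPDE Literature.MathematicalPhysics.KineticTheory

/-- Sanity: the crux is literally `KineticFluxLdDecay → RelEntropyVanishing`. -/
example : KineticWindowGronwall = (KineticFluxLdDecay → RelEntropyVanishing) := rfl

/-! ## §1 Registered stubs (v5: six existing board items, by name) -/

/-- STUB 1 — SEET (stmt-17701): super-exponential cubic velocity tails under the true pre-shock law (rate form of `EnergyCurrentTails`). -/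
theorem stub_seet : OneFlightGossipEngine.SuperExponentialEnergyTails := by
  sorry

/-- STUB 2 — KCWF-Q (stmt-18052): kinetic-currents window LD along families, class-uniform tilt (⟸ `KCWUSharpPlus`, 16659's stub, landed). -/
theorem stub_kcwfQ : OneFlightGossipEngine.KineticCurrentsLDAlongFamiliesQ := by
  sorry

/-- STUB 3 — LCTF (stmt-17691): local transfer-clamped collisional window LD along families. -/
theorem stub_lctf : OneFlightGossipEngine.LocalClampedTransferLDAlongFamilies := by
  sorry

/-- STUB 4 — EAT (stmt-17703): a-priori L¹ tails of the window energy-transfer activity under the true law. -/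
theorem stub_eat : OneFlightGossipEngine.EnergyActivityTails := by
  sorry

/-- STUB 5 — CAT (stmt-13734): a-priori L¹ tails of the window collisional activity under the true law. -/
theorem stub_cat : OneFlightGossipEngine.CollisionActivityTails := by
  sorry

/-- STUB 6 — DSC (stmt-3091): dilute self-consistency (un-guards the in-band Yau target). -/
theorem stub_dsc : DiluteSelfConsistency := by
  sorry

/-! ## §2 The composition (kernel-checked, no sorry of its own; LANDED p163058 as
`Theorems/AntiMazurCoboundariesKineticWindowGronwallSignedDock.lean`): the six stubs imply the crux BY NAME -/

/-- **The guarded Grönwall core from the five signed inputs** (landed `KineticWindowGronwallSignedDock.gronwallCoreInBand_of_signedItems`: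
the `have`-chain of `HydroLimitInBandSignedBand.hydroLimitInBand_of_signedInputs`, crux 9133 lead c17, stopped one line early, KCWF-Q read as
the route item stmt-18052). -/
theorem gronwallCoreInBand_of_signedItems (hS : OneFlightGossipEngine.SuperExponentialEnergyTails)
    (hQ : OneFlightGossipEngine.KineticCurrentsLDAlongFamiliesQ) (hL : OneFlightGossipEngine.LocalClampedTransferLDAlongFamilies)
    (hE : OneFlightGossipEngine.EnergyActivityTails) (hC : OneFlightGossipEngine.CollisionActivityTails) : GronwallCoreInBand :=
  KineticWindowGronwallSignedDock.gronwallCoreInBand_of_signedItems hS hQ hL hE hC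

/-- The crux's consequent from the six stub statements (landed `KineticWindowGronwallSignedDock.relEntropyVanishing_of_signedItems`: the core
un-guarded by `DiluteSelfConsistency`, `KineticWindowGronwallClockFromInstance.relEntropyVanishing_of_gronwallCoreInBand`, lead c3). -/
theorem relEntropyVanishing_of_signedItems (hS : OneFlightGossipEngine.SuperExponentialEnergyTails)
    (hQ : OneFlightGossipEngine.KineticCurrentsLDAlongFamiliesQ) (hL : OneFlightGossipEngine.LocalClampedTransferLDAlongFamilies)
    (hE : OneFlightGossipEngine.EnergyActivityTails) (hC : OneFlightGossipEngine.CollisionActivityTails) (hD : DiluteSelfConsistency) :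
    RelEntropyVanishing :=
  KineticWindowGronwallSignedDock.relEntropyVanishing_of_signedItems hS hQ hL hE hC hD

/-- `stub_seet → stub_kcwfQ → stub_lctf → stub_eat → stub_cat → stub_dsc → KineticWindowGronwall` (the item's primary decl, route
FluxGibbsianityLdDrude; same term as AntiMazurCoboundaries'). The antecedent `A` is idle (module docstring, HONESTY). -/
theorem KineticWindowGronwall_of :
    OneFlightGossipEngine.SuperExponentialEnergyTails → OneFlightGossipEngine.KineticCurrentsLDAlongFamiliesQ →
      OneFlightGossipEngine.LocalClampedTransferLDAlongFamilies → OneFlightGossipEngine.EnergyActivityTails →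
      OneFlightGossipEngine.CollisionActivityTails → DiluteSelfConsistency →
      Summit.AtomisticToContinuum.HydrodynamicLimit.Theses.FluxGibbsianityLdDrude.KineticWindowGronwall :=
  fun hS hQ hL hE hC hD _ => relEntropyVanishing_of_signedItems hS hQ hL hE hC hD

/-- The same composition for the sibling decl (route AntiMazurCoboundaries; same term). -/
theorem KineticWindowGronwall_of' :
    OneFlightGossipEngine.SuperExponentialEnergyTails → OneFlightGossipEngine.KineticCurrentsLDAlongFamiliesQ →
      OneFlightGossipEngine.LocalClampedTransferLDAlongFamilies → OneFlightGossipEngine.EnergyActivityTails →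
      OneFlightGossipEngine.CollisionActivityTails → DiluteSelfConsistency →
      Summit.AtomisticToContinuum.HydrodynamicLimit.Theses.AntiMazurCoboundaries.KineticWindowGronwall :=
  KineticWindowGronwall_of

/-- Helper statement `SignedDockGlue` (registered helper stub `stub_signedDockGlue`; landed as
`Theorems/AntiMazurCoboundariesKineticWindowGronwallSignedDock.lean`): the six board items imply the crux (sibling decl). Route-internal
bookkeeping — the `--glue-by` shape of a six-way split of stmt-9282 onto 17701/18052/17691/17703/13734/3091. -/
def SignedDockGlue : Prop :=
  OneFlightGossipEngine.SuperExponentialEnergyTails → OneFlightGossipEngine.KineticCurrentsLDAlongFamiliesQ →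
    OneFlightGossipEngine.LocalClampedTransferLDAlongFamilies → OneFlightGossipEngine.EnergyActivityTails →
    OneFlightGossipEngine.CollisionActivityTails → DiluteSelfConsistency →
    Summit.AtomisticToContinuum.HydrodynamicLimit.Theses.AntiMazurCoboundaries.KineticWindowGronwall

/-- **Registered helper stub `stub_signedDockGlue`** (PROVED here; the landed twin is
`KineticWindowGronwallSignedDock.stub_signedDockGlue`): `SignedDockGlue` holds. -/
theorem stub_signedDockGlue : SignedDockGlue :=
  KineticWindowGronwall_of'

/-- The crux from the registered stubs (every `sorry` sits inside a `stub_*`). -/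
theorem KineticWindowGronwall_skeleton :
    Summit.AtomisticToContinuum.HydrodynamicLimit.Theses.FluxGibbsianityLdDrude.KineticWindowGronwall :=
  KineticWindowGronwall_of stub_seet stub_kcwfQ stub_lctf stub_eat stub_cat stub_dsc

/-- The shared sibling decl (route AntiMazurCoboundaries, same item 9282) is the same term, so the skeleton serves both. -/
example : Summit.AtomisticToContinuum.HydrodynamicLimit.Theses.AntiMazurCoboundaries.KineticWindowGronwall =
    Summit.AtomisticToContinuum.HydrodynamicLimit.Theses.FluxGibbsianityLdDrude.KineticWindowGronwall := rfl

/-- Entry point for the sibling decl. -/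
theorem KineticWindowGronwall_proof' :
    Summit.AtomisticToContinuum.HydrodynamicLimit.Theses.AntiMazurCoboundaries.KineticWindowGronwall :=
  KineticWindowGronwall_skeleton

/-! ## §3 Honesty / compatibility lemmas (sorry-free) -/

/-- The registered helper shape `SignedDockGlue` IS the landed glue (p163058, `KineticWindowGronwallSignedDock.stub_signedDockGlue`, one-line
fully qualified header = the registered signature of `stub_signedDockGlue`). -/
theorem landed_glue_agrees : SignedDockGlue :=
  KineticWindowGronwallSignedDock.stub_signedDockGlue

/-- **The v4/split child 1 feeds the new kinetic stub** (landed `KineticWindowGronwallSignedDock.kcwfQ_of_child₁`): the bounds-uniform general-`F`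
node `KineticWindowLDBoundsUniform` gives the route item KCWF-Q (stmt-18052) — through crux 16659's registered stub shape `KCWUSharpPlus` (the
structured class is a subclass of the continuous quadratic-growth class; normalise `F` by `max C 1`, tilt radius `β₀ / max C 1`) and the landed
`HydroLimitProfilewiseBandKcwfQ.kcwfQ_of_kcwuSharpPlus`. So the already-requested split child 1 remains SUFFICIENT for `stub_kcwfQ`. -/
theorem kcwfQ_of_child₁ (hU : KineticWindowGronwallSplit.KineticWindowLDBoundsUniform) :
    OneFlightGossipEngine.KineticCurrentsLDAlongFamiliesQ :=
  KineticWindowGronwallSignedDock.kcwfQ_of_child₁ hU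

/-- **The v4 registered stubs still close the crux, WITHOUT the coherence child** (landed `KineticWindowGronwallSignedDock.kineticWindowGronwall_of_child₁`):
child 1 (node) and child 3's items 17691 ∧ 3091, together with SEET, EAT, CAT, give the crux — `CoherentSuprathermalContentVanishesW`,
`TransferActivityTails` (16624) and `EnergyCurrentTails` (9235) are no longer consumed. -/
theorem kineticWindowGronwall_of_child₁ (hU : KineticWindowGronwallSplit.KineticWindowLDBoundsUniform)
    (hS : OneFlightGossipEngine.SuperExponentialEnergyTails) (hL : OneFlightGossipEngine.LocalClampedTransferLDAlongFamilies)
    (hE : OneFlightGossipEngine.EnergyActivityTails) (hC : OneFlightGossipEngine.CollisionActivityTails) (hD : DiluteSelfConsistency) :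
    KineticWindowGronwall :=
  KineticWindowGronwallSignedDock.kineticWindowGronwall_of_child₁ hU hS hL hE hC hD

/-- The OLD split glue (p154260) is implied: v4's three children give v5's kinetic stub and two of the others; the remaining three (SEET, EAT, CAT)
are what v5 asks INSTEAD of child 2 + 16624 + 9235. Recorded so that both `children.json` packages on the item stay comparable. -/
theorem old_children_give_kcwfQ (h₁ : KineticWindowGronwallSplit.KineticWindowLDBoundsUniform)
    (_h₂ : KineticWindowGronwallSplit.CoherentSuprathermalContentVanishesW) (h₃ : KineticWindowGronwallSplit.ClockBoardInputs) :
    OneFlightGossipEngine.KineticCurrentsLDAlongFamiliesQ ∧ OneFlightGossipEngine.LocalClampedTransferLDAlongFamilies ∧ DiluteSelfConsistency :=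
  ⟨kcwfQ_of_child₁ h₁, h₃.1, h₃.2.2.2⟩

/-- Given 14440 the crux's antecedent is formally idle (landed): `EquilibriumFastWindowLD → KineticFluxLdDecay`. -/
theorem antecedent_of_equilibriumFastWindowLD (h₀ : EquilibriumFastWindowLD) : KineticFluxLdDecay :=
  KineticWindowGronwallRareBandDock.kineticFluxLdDecay_of_equilibriumFastWindowLD h₀

end Summit.AtomisticToContinuum.HydrodynamicLimit.Cruxes.KineticWindowGronwall.BoardNodeDock

end
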